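import Literature.AlgebraicGeometry.Deformation.AdaptedObstructionContract
import Literature.AlgebraicGeometry.Deformation.AdaptedObstructionTraceClass
import HarnessLib

/-!
# Additivity of `σ₀` and `σ₁` of the Čech obstruction classes along a short exact sequence (adapted data)

Setting of `Deformation/AdaptedLifts.lean`, `Deformation/AdaptedObstructionTrace.lean`,
`Deformation/AdaptedObstructionContract.lean`: `Y` a scheme over `Spec k`, `j : Y ⟶ Z₀`, `i : Z₀ ⟶ Z₁`,
`eI : i_* j_* 𝒪_Y ≅ 𝓘`, a short exact sequence `0 → F₁ → F₂ → F₃ → 0` of `𝒪_{Z₀}`-modules with `j^*F_m`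
finite locally free, an ADAPTED frame cover `A` over opens `U_a ⊆ Z₁` whose traces `j⁻¹i⁻¹U_a` cover `Y`,
ADAPTED lifts `T̃² = [[T̃¹, X],[0, T̃³]]`, and the three Čech obstruction cocycles
`ω_m = toLocalFamily κ(c^m)` of `𝓔nd(j^*F_m)` with their classes `[ω_m] ∈ Ext²(j^*F_m, j^*F_m)`
(`Cech.classOf` for the exact Čech augmentation of the common cover).

* `sigmaZero_classOf_adapted` — **`σ₀[ω₂] = σ₀[ω₁] + σ₀[ω₃]` in `H²(Y, 𝒪_Y)`**: `σ₀ = H(Tr)`,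
  `Tr[ω] = [tr_* ω]` (`Cech.traceExt_classOf`) and the local traces add up
  (`trace_toLocalFamily_defectCochain_adapted`, `Deformation/AdaptedObstructionTraceClass.lean`: block upper
  triangular cocycles; this is `traceExt_classOf_defectCochain_adapted` there, read in `H²`);
* `sigmaOne_classOf_adapted` — **`σ₁[ω₂] = σ₁[ω₁] + σ₁[ω₃]` in `H³(Y, Ω¹_{Y/k})`**: `σ₁(x) = H(Tr_{Ω¹}(x ∘ At))`,
  `At(E_m) = [At-cocycle of the base framing]` (`atiyahClass_eq_classOf_exactAugmentation`),
  `[ω] ∘ [At] = [ω ∪ At]` (`Cech.classOf_cupFamily`), `Tr_{Ω¹}[c] = [c_{Ω¹,*} c]`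
  (`Cech.traceExtCoeff_classOf`) and the local contractions add up
  (`contract_cupFamily_atiyahCocycle_adapted`).

This is Buchweitz–Flenner 2003, Prop. 4.2 (additivity of `σ = tr(e^{-At} · ob)` along short exact
sequences, there deduced from `σ_k(ob) = ⟨[Z₁], ch_{k+1}⟩`), in degrees `0, 1`, for the Čech model of the
obstruction class of the tree. Everything is proved; no named facts.

## References

* R.-O. Buchweitz, H. Flenner, *A semiregularity map for modules and applications to deformations*,
  Compositio Math. 137 (2003), Prop. 4.2. [BuchweitzFlenner2003]
* R. Hartshorne, *Deformation Theory*, GTM 257 (2010), §7. [Hartshorne2010]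
-/

noncomputable section

universe u

open CategoryTheory AlgebraicGeometry Opposite TopologicalSpace CategoryTheory.Abelian

namespace Literature.AlgebraicGeometry.Deformation

open Literature.AlgebraicGeometry.Modules Literature.AlgebraicGeometry.Motives
  Literature.AlgebraicGeometry.HodgeTheory

variable {k : Type u} [CommRing k] {Y : Over (Spec (CommRingCat.of k))} {Z₀ Z₁ : Scheme.{u}}
  {j : Y.left ⟶ Z₀} {i : Z₀ ⟶ Z₁}
  (eI : (Scheme.Modules.pushforward i).obj ((Scheme.Modules.pushforward j).obj (unitModule Y.left)) ≅
    idealModule i)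
  {S : ShortComplex Z₀.Modules} {hS : S.ShortExact} {ι : Type u} {A : AdaptedFrameCover i S ι}
  (L₁ : A.cover₁.Lifts) (L₃ : A.cover₃.Lifts)
  (X : ∀ a b, Matrix (A.I₁ a) (A.I₃ b) Γ(Z₁, A.U a ⊓ A.U b))
  (hX : ∀ a b, (X a b).map (i.app (A.U a ⊓ A.U b)).hom =
    A.offDiag (hS := hS) a b (A.U a ⊓ A.U b) inf_le_left inf_le_right)
  (h₁ : IsFiniteLocallyFree ((Scheme.Modules.pullback j).obj S.X₁))
  (h₂ : IsFiniteLocallyFree ((Scheme.Modules.pullback j).obj S.X₂))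
  (h₃ : IsFiniteLocallyFree ((Scheme.Modules.pullback j).obj S.X₃))
  (hU : iSup (fun a => baseOpen j i (A.U a)) = ⊤)
  [HasExt.{u + 1} Y.left.Modules]

/-- **`σ₀` of the Čech obstruction classes is additive along a short exact sequence with adapted data.**
[cite: BuchweitzFlenner2003, Prop. 4.2] -/
theorem sigmaZero_classOf_adapted
    (hω₁ : Cech.dFamily ((A.cover₁.baseFraming j).toLocalFamily (L₁.defectCochain eI)) = 0)
    (hω₂ : Cech.dFamily (((A.cover₂ hS).baseFraming j).toLocalFamily
      ((AdaptedFrameCover.Lifts.adapted (hS := hS) L₁ L₃ X hX).defectCochain eI)) = 0)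
    (hω₃ : Cech.dFamily ((A.cover₃.baseFraming j).toLocalFamily (L₃.defectCochain eI)) = 0) :
    sigmaZero h₂ (Cech.classOf (Cech.exactAugmentation ((A.cover₂ hS).baseFraming j).U _ hU)
        (((A.cover₂ hS).baseFraming j).toLocalFamily
          ((AdaptedFrameCover.Lifts.adapted (hS := hS) L₁ L₃ X hX).defectCochain eI)) hω₂) =
      sigmaZero h₁ (Cech.classOf (Cech.exactAugmentation (A.cover₁.baseFraming j).U _ hU)
          ((A.cover₁.baseFraming j).toLocalFamily (L₁.defectCochain eI)) hω₁) +
        sigmaZero h₃ (Cech.classOf (Cech.exactAugmentation (A.cover₃.baseFraming j).U _ hU)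
          ((A.cover₃.baseFraming j).toLocalFamily (L₃.defectCochain eI)) hω₃) := by
  rw [sigmaZero_apply, sigmaZero_apply, sigmaZero_apply]
  exact (congrArg _ (Cech.traceExt_classOf_eq_add hU h₁ h₂ h₃ _ _ _ hω₁ hω₂ hω₃
    (trace_toLocalFamily_defectCochain_adapted eI (hS := hS) L₁ L₃ X hX h₁ h₂ h₃))).trans (map_add _ _ _)

/-- **`σ₁` of the Čech obstruction classes is additive along a short exact sequence with adapted data.**
[cite: BuchweitzFlenner2003, Prop. 4.2] -/
theorem sigmaOne_classOf_adapted
    (hω₁ : Cech.dFamily ((A.cover₁.baseFraming j).toLocalFamily (L₁.defectCochain eI)) = 0)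
    (hω₂ : Cech.dFamily (((A.cover₂ hS).baseFraming j).toLocalFamily
      ((AdaptedFrameCover.Lifts.adapted (hS := hS) L₁ L₃ X hX).defectCochain eI)) = 0)
    (hω₃ : Cech.dFamily ((A.cover₃.baseFraming j).toLocalFamily (L₃.defectCochain eI)) = 0) :
    sigmaOne h₂ (Cech.classOf (Cech.exactAugmentation ((A.cover₂ hS).baseFraming j).U _ hU)
        (((A.cover₂ hS).baseFraming j).toLocalFamily
          ((AdaptedFrameCover.Lifts.adapted (hS := hS) L₁ L₃ X hX).defectCochain eI)) hω₂) =
      sigmaOne h₁ (Cech.classOf (Cech.exactAugmentation (A.cover₁.baseFraming j).U _ hU)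
          ((A.cover₁.baseFraming j).toLocalFamily (L₁.defectCochain eI)) hω₁) +
        sigmaOne h₃ (Cech.classOf (Cech.exactAugmentation (A.cover₃.baseFraming j).U _ hU)
          ((A.cover₃.baseFraming j).toLocalFamily (L₃.defectCochain eI)) hω₃) := by
  -- the three cup products `ω_m ∪ At_m` and the additivity of their local contractions
  have h := Cech.traceExtCoeff_classOf_eq_add hU (cotangentSheaf Y) h₁ h₂ h₃
    (Cech.cupFamily (atiyahCocycle (A.cover₁.baseFraming j))
      ((A.cover₁.baseFraming j).toLocalFamily (L₁.defectCochain eI)))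
    (Cech.cupFamily (atiyahCocycle ((A.cover₂ hS).baseFraming j))
      (((A.cover₂ hS).baseFraming j).toLocalFamily
        ((AdaptedFrameCover.Lifts.adapted (hS := hS) L₁ L₃ X hX).defectCochain eI)))
    (Cech.cupFamily (atiyahCocycle (A.cover₃.baseFraming j))
      ((A.cover₃.baseFraming j).toLocalFamily (L₃.defectCochain eI)))
    (Cech.dFamily_cupFamily _ (dFamily_atiyahCocycle _) _ hω₁)
    (Cech.dFamily_cupFamily _ (dFamily_atiyahCocycle _) _ hω₂)
    (Cech.dFamily_cupFamily _ (dFamily_atiyahCocycle _) _ hω₃)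
    (contract_cupFamily_atiyahCocycle_adapted eI (hS := hS) L₁ L₃ X hX h₁ h₂ h₃)
  -- `[ω ∪ At] = [ω] ∘ [At] = [ω] ∘ At(E)`
  -- (the cocycle side conditions of the three rewrites are discharged at the end)
  rw [Cech.classOf_cupFamily _ _ _ (Cech.exactAugmentation_ε _ _ hU),
    Cech.classOf_cupFamily _ _ _ (Cech.exactAugmentation_ε _ _ hU),
    Cech.classOf_cupFamily _ _ _ (Cech.exactAugmentation_ε _ _ hU),
    ← atiyahClass_eq_classOf_exactAugmentation (A.cover₁.baseFraming j) hU,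
    ← atiyahClass_eq_classOf_exactAugmentation ((A.cover₂ hS).baseFraming j) hU,
    ← atiyahClass_eq_classOf_exactAugmentation (A.cover₃.baseFraming j) hU] at h
  · rw [sigmaOne_apply, sigmaOne_apply, sigmaOne_apply]
    exact (congrArg (extToCohomology (cotangentSheaf Y) 3) h).trans (map_add _ _ _)
  all_goals first | exact dFamily_atiyahCocycle _ | assumption

/-! ### Existence of adapted affine data -/

section Existence

variable (i)

/-- **Adapted affine data exist** for a short exact sequence of finite locally free `𝒪_{Z₀}`-modules
across a surjective closed immersion `i : Z₀ ⟶ Z₁` into a SEPARATED scheme: the canonical adapted frame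
cover by affine opens `U_x ∋ i(x)` indexed by the points of `Z₀` (`adaptedFrameCover`), with affine
pairwise intersections (so that lifts of the transition matrices of `F₁`, `F₃` exist,
`liftsOfIsAffineOpen`) and lifts of the off-diagonal blocks (`exists_offDiag_lift`). [cite: Hartshorne2010, §7 (proof of Thm. 7.1)] -/
theorem exists_adaptedData [IsClosedImmersion i] [Surjective i] [Z₁.IsSeparated] (hS : S.ShortExact)
    (hF₁ : IsFiniteLocallyFree S.X₁) (hF₃ : IsFiniteLocallyFree S.X₃) :
    ∃ (A : AdaptedFrameCover i S Z₀) (X : ∀ a b, Matrix (A.I₁ a) (A.I₃ b) Γ(Z₁, A.U a ⊓ A.U b)),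
      (∀ a b, (X a b).map (i.app (A.U a ⊓ A.U b)).hom =
        A.offDiag (hS := hS) a b (A.U a ⊓ A.U b) inf_le_left inf_le_right) ∧
      (∀ x, IsAffineOpen (A.U x)) ∧ (∀ x y, IsAffineOpen (A.U x ⊓ A.U y)) ∧ ⨆ x, A.U x = ⊤ ∧
      (∀ x, i.base x ∈ A.U x) := by
  have hUaff := isAffineOpen_adaptedFrameCover_U i hS hF₁ hF₃
  have hU2 : ∀ x y, IsAffineOpen ((adaptedFrameCover i hS hF₁ hF₃).U x ⊓ (adaptedFrameCover i hS hF₁ hF₃).U y) :=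
    fun x y => (hUaff x).inf (hUaff y)
  obtain ⟨X, hX⟩ := AdaptedFrameCover.Lifts.exists_offDiag_lift (A := adaptedFrameCover i hS hF₁ hF₃) (hS := hS) hU2
  exact ⟨adaptedFrameCover i hS hF₁ hF₃, X, hX, hUaff, hU2, iSup_adaptedFrameCover_U i hS hF₁ hF₃,
    mem_affineAdaptedOpen i hS hF₁ hF₃⟩

end Existence

end Literature.AlgebraicGeometry.Deformation

end
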